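import Literature.NumberTheory.PAdicHodge.DeRhamOfPeriodHoms
import Literature.NumberTheory.PAdicHodge.BdRPlusLog
import HarnessLib

/-!
# Legendre transversality of a period pair from TATE's theorem: `Δ = φ₁(v₀)φ₂(v₁) − φ₁(v₁)φ₂(v₀) ∉ Fil² B_dR`

Topic `Literature/NumberTheory/PAdicHodge`; namespace `Literature.NumberTheory.PAdicHodge`. THEOREMS ONLY (no definition, no named
fact, no instance, no `sorry`). Inputs: Fontaine's datum `bdRPeriodRingData hp` (`B_dR(F)`, `Fil^i = ξ^i B_dR⁺`), Fontaine's
`t ∈ B_dR⁺` (`BdRPlusLog`: `σ t = χ(σ) t`, `t = ξ·unit`), and TATE'S THEOREM `ℂ_F(χ^j)^{Γ_F} = 0` for `j ≠ 0` (`TateTwistInvariants`).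

**`det_not_mem_fil_two_of_periodHoms`.** Let `ρ` be a continuous `ℚ_p`-representation of `Γ_F` on `V` with a basis `(v₀, v₁)`, and
`φ₁, φ₂ : V → B_dR(F)` `ℚ_p`-linear and `Γ_F`-equivariant with `φ₁(V) ⊆ Fil¹`, `φ₂(V) ⊆ Fil⁰ = B_dR⁺`, `φ₁(m₁) ∉ Fil²` for some `m₁`
and `φ₂(m₂) ∉ Fil¹` for some `m₂` (the shape of the two `p`-adic periods `∫ω`, `∫η` of an elliptic curve / a `p`-divisible group of
height 2 and dimension 1: `∫ω ∈ Fil¹`, Hodge–Tate map `≢ 0`, `θ(∫η) ≢ 0`). Then the period determinant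
`Δ = φ₁(v₀)φ₂(v₁) − φ₁(v₁)φ₂(v₀)` is NOT in `Fil²` — i.e. `Δ ∈ t·(B_dR⁺)ˣ`, the valuation content of Legendre's relation.

Proof. Write `φ₁(vᵢ) = t·aᵢ`, `φ₂(vᵢ) = cᵢ` with `aᵢ, cᵢ ∈ B_dR⁺`, and `hᵢ = θ(aᵢ)`, `eᵢ = θ(cᵢ) ∈ ℂ_F`. Equivariance and `σt = χ(σ)t` give,
with `r(σ) = θ(R(σ))` the matrix of `ρ(σ)` read in `ℂ_F`: `χ(σ)·σ(h⃗) = h⃗·r(σ)` and `σ(e⃗) = e⃗·r(σ)`. If `Δ ∈ Fil²` then `h₀e₁ = h₁e₀`.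
If `e⃗ = 0` then `φ₂(V) ⊆ Fil¹`, contradiction. Otherwise `h⃗ = λe⃗` and the two transformation laws force `σ(λ) = χ(σ)⁻¹λ` for all
`σ`, so `λ = 0` by Tate (`j = −1`), `h⃗ = 0`, `φ₁(V) ⊆ Fil²`, contradiction.

Use: the `Fil⁰`-coboundary criterion `isFilZeroCoboundary_of_pair_of_legendre` / `BdRLegendreDivisibility` (brick K1 of the hT₂
programme of crux K★ `stmt-BirchSwinnertonDyer-22226`), whose only non-formal hypothesis was this transversality. BSD / K★ are not
proved by any of this.

## References
* [Tate1967] J. Tate, *p-divisible groups* (1967), §3.3 Thm. 2, §4 (Hodge–Tate decomposition; `ℂ(χ)^Γ = 0`).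
* [Colmez1992PeriodesAbeliennes] P. Colmez, Math. Ann. 292 (1992), §2 (Legendre's relation for `p`-adic periods).
* [FontaineAsterisque223III] J.-M. Fontaine, Astérisque 223 (1994), Exp. II §1.5.4–1.5.5.
-/

noncomputable section

open scoped TensorProduct

namespace Literature.NumberTheory.PAdicHodge

open Literature Literature.NumberTheory.GaloisRepresentations
open Literature.NumberTheory.GaloisRepresentations.IsNonarchimedeanLocalField Field ValuativeRel WittVector

variable {F : Type} [Field F] [ValuativeRel F] [TopologicalSpace F] [IsNonarchimedeanLocalField F] [CharZero F]
  {p : ℕ} [Fact p.Prime] [Fact (¬ IsUnit (p : integerC F))] [IsAdicComplete (Ideal.span {(p : integerC F)}) (integerC F)]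
  (hp : valuation F p < 1) [Algebra ℚ_[p] F]

/-! ## §1 Scalars and `θ` in Fontaine's datum -/

omit [Fact (¬ IsUnit (p : integerC F))] [IsAdicComplete (Ideal.span {(p : integerC F)}) (integerC F)] [Algebra ℚ_[p] F] in
/-- `θ(χ(σ)) ≠ 0`: the cyclotomic scalar `χ(σ) ∈ ℤ_pˣ` read in `ℂ_F` through `ℚ_p → F → ℂ_F`. [cite: Tate1967, §3.3] -/
theorem algebraMap_padicRingHom_cyclotomicCharacter_ne_zero (σ : absoluteGaloisGroup F) :
    algebraMap F (CompletedAlgClosure F) (LocalField.padicRingHom F p hp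
      (((GaloisRep.cyclotomicCharacter F p σ : ℤ_[p]ˣ) : ℤ_[p]) : ℚ_[p])) ≠ 0 := by
  rw [map_ne_zero_iff _ (algebraMap F (CompletedAlgClosure F)).injective,
    map_ne_zero_iff _ (LocalField.padicRingHom F p hp).injective, ne_eq, PadicInt.coe_eq_zero]
  exact (GaloisRep.cyclotomicCharacter F p σ).ne_zero

/-! ## §2 The transversality theorem -/

set_option maxHeartbeats 800000 in
/-- **Legendre transversality from Tate's theorem.** `ρ` on `V` (basis `v`), `φ₁, φ₂ : V → B_dR(F)` `ℚ_p`-linear and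
`Γ_F`-equivariant, `φ₁ ⊆ Fil¹`, `φ₂ ⊆ Fil⁰`, `φ₁(m₁) ∉ Fil²` and `φ₂(m₂) ∉ Fil¹` for some `m₁, m₂`. Then
`φ₁(v₀)φ₂(v₁) − φ₁(v₁)φ₂(v₀) ∉ Fil² B_dR`. [cite: Tate1967, §3.3 Theorem 2 and §4] [cite: Colmez1992PeriodesAbeliennes, §2] -/
theorem det_not_mem_fil_two_of_periodHoms {M : Type} [AddCommGroup M] [Module ℚ_[p] M] [TopologicalSpace M]
    (ρ : ContinuousRep (absoluteGaloisGroup F) ℚ_[p] M) (v : Module.Basis (Fin 2) ℚ_[p] M)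
    (φ₁ φ₂ : M →ₗ[ℚ_[p]] (bdRPeriodRingData (F := F) (p := p) hp).B)
    (h₁ : ∀ σ m, φ₁ (ρ σ m) = σ • φ₁ m) (h₂ : ∀ σ m, φ₂ (ρ σ m) = σ • φ₂ m)
    (hfil₁ : ∀ m, φ₁ m ∈ (bdRPeriodRingData (F := F) (p := p) hp).fil 1)
    (hfil₂ : ∀ m, φ₂ m ∈ (bdRPeriodRingData (F := F) (p := p) hp).fil 0)
    (hne : ∃ m, φ₁ m ∉ (bdRPeriodRingData (F := F) (p := p) hp).fil 2)
    (hnot : ∃ m, φ₂ m ∉ (bdRPeriodRingData (F := F) (p := p) hp).fil 1) :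
    φ₁ (v 0) * φ₂ (v 1) - φ₁ (v 1) * φ₂ (v 0) ∉ (bdRPeriodRingData (F := F) (p := p) hp).fil 2 := by
  classical
  intro hΔ
  have hF := surjective_fontaineTheta_integerC hp
  haveI : IsDomain (BDeRhamPlus (integerC F) p) := isDomain_bDeRhamPlus hF
  letI : Algebra F (FracBdR F p) := fracAlgebra hp hF
  let alg : BDeRhamPlus (integerC F) p →+* FracBdR F p := algebraMap (BDeRhamPlus (integerC F) p) (FracBdR F p)
  have halg : Function.Injective alg := algebraMap_fracBdR_injective
  have mem_fil : ∀ (i : ℤ) (x : (bdRPeriodRingData (F := F) (p := p) hp).B),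
      x ∈ (bdRPeriodRingData (F := F) (p := p) hp).fil i ↔ ∃ b : BDeRhamPlus (integerC F) p, x = alg xiBdR ^ i * alg b :=
    fun i x => mem_fil_iff hp hF
  -- `t = ξ w`, `t ≠ 0`
  obtain ⟨w, hw, htw⟩ := exists_tBdR_eq_xiBdR_mul (F := F) (p := p) hF
  have hξ0 : (xiBdR : BDeRhamPlus (integerC F) p) ≠ 0 := fun h =>
    algebraMap_xiBdR_ne_zero (F := F) (p := p) hF (by rw [h, map_zero])
  have ht0 : alg tBdR ≠ 0 := (map_ne_zero_iff _ halg).2 (tBdR_ne_zero hF)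
  -- representatives: `φ₁ m = t · a m`, `φ₂ m = c m`
  have rep1 : ∀ m, ∃ a : BDeRhamPlus (integerC F) p, φ₁ m = alg tBdR * alg a := fun m => by
    obtain ⟨b, hb⟩ := (mem_fil 1 _).1 (hfil₁ m)
    refine ⟨((hw.unit⁻¹ : (BDeRhamPlus (integerC F) p)ˣ) : BDeRhamPlus (integerC F) p) * b, ?_⟩
    rw [hb, zpow_one, htw, ← map_mul, ← map_mul]
    congr 1
    rw [mul_assoc, ← mul_assoc w, IsUnit.mul_val_inv, one_mul]
  have rep2 : ∀ m, ∃ c : BDeRhamPlus (integerC F) p, φ₂ m = alg c := fun m => by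
    obtain ⟨b, hb⟩ := (mem_fil 0 _).1 (hfil₂ m)
    exact ⟨b, by rw [hb, zpow_zero, one_mul]⟩
  choose a ha using rep1
  choose c hc using rep2
  -- the scalars of `ρ(σ)` in the basis, read in `B_dR⁺` and in `ℂ_F`
  let R : absoluteGaloisGroup F → Matrix (Fin 2) (Fin 2) ℚ_[p] := fun σ => LinearMap.toMatrix v v (ρ σ)
  let ιB : ℚ_[p] → BDeRhamPlus (integerC F) p := fun q => embBdRHom hp hF (algebraMap ℚ_[p] F q)
  let ιC : ℚ_[p] → CompletedAlgClosure F := fun q => algebraMap F (CompletedAlgClosure F) (algebraMap ℚ_[p] F q)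
  have hιθ : ∀ q, thetaBdR (ιB q) = ιC q := fun q => thetaBdR_embBdRHom hp hF _
  let χq : absoluteGaloisGroup F → ℚ_[p] := fun σ => (((GaloisRep.cyclotomicCharacter F p σ : ℤ_[p]ˣ) : ℤ_[p]) : ℚ_[p])
  let χC : absoluteGaloisGroup F → CompletedAlgClosure F := fun σ =>
    algebraMap F (CompletedAlgClosure F) (LocalField.padicRingHom F p hp (χq σ))
  have hχθ : ∀ σ, thetaBdR (qpToBdR (χq σ) : BDeRhamPlus (integerC F) p) = χC σ := fun σ => thetaBdR_qpToBdR hp _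
  -- (E) equivariance in coordinates: `σ φ(v j) = Σ_k φ(v k) · R k j`, read in `B_dR⁺`
  have hE₁ : ∀ σ j, qpToBdR (χq σ) * galBdRPlus σ (a (v j)) = ∑ k, a (v k) * ιB (R σ k j) := fun σ j => by
    have h := (bdRPeriodRingData (F := F) (p := p) hp).smul_apply_basis_of_equivariant ρ v (φ := φ₁) (h₁) σ j
    rw [ha (v j)] at h
    -- re-read `h` in `B_dR = Frac B_dR⁺`
    have h' : (MulSemiringAction.toRingHom (absoluteGaloisGroup F) (FracBdR F p) σ) (alg tBdR * alg (a (v j))) =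
        ∑ k, alg tBdR * alg (a (v k)) * alg (ιB (R σ k j)) :=
      h.trans (Finset.sum_congr rfl fun k _ => by rw [ha (v k)]; rfl)
    rw [map_mul, ← smul_fracBdR_eq_toRingHom, ← smul_fracBdR_eq_toRingHom, smul_algebraMap_fracBdR,
      smul_algebraMap_fracBdR, galBdRPlus_tBdR] at h'
    have h'' : alg tBdR * alg (qpToBdR (χq σ) * galBdRPlus σ (a (v j))) = alg tBdR * alg (∑ k, a (v k) * ιB (R σ k j)) := by
      calc alg tBdR * alg (qpToBdR (χq σ) * galBdRPlus σ (a (v j)))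
          = alg (qpToBdR (χq σ) * tBdR) * alg (galBdRPlus σ (a (v j))) := by rw [map_mul, map_mul]; ring
        _ = ∑ k, alg tBdR * alg (a (v k)) * alg (ιB (R σ k j)) := h'
        _ = alg tBdR * alg (∑ k, a (v k) * ιB (R σ k j)) := by
            rw [map_sum, Finset.mul_sum]
            exact Finset.sum_congr rfl fun k _ => by rw [map_mul, mul_assoc]
    exact halg (mul_left_cancel₀ ht0 h'')
  have hE₂ : ∀ σ j, galBdRPlus σ (c (v j)) = ∑ k, c (v k) * ιB (R σ k j) := fun σ j => by
    have h := (bdRPeriodRingData (F := F) (p := p) hp).smul_apply_basis_of_equivariant ρ v (φ := φ₂) (h₂) σ j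
    rw [hc (v j)] at h
    have h' : (MulSemiringAction.toRingHom (absoluteGaloisGroup F) (FracBdR F p) σ) (alg (c (v j))) =
        ∑ k, alg (c (v k)) * alg (ιB (R σ k j)) :=
      h.trans (Finset.sum_congr rfl fun k _ => by rw [hc (v k)]; rfl)
    rw [← smul_fracBdR_eq_toRingHom, smul_algebraMap_fracBdR] at h'
    apply halg
    rw [h', map_sum]
    exact Finset.sum_congr rfl fun k _ => by rw [map_mul]
  -- in `ℂ_F`: `χ(σ) σ(h j) = Σ_k h k · r k j`, `σ(e j) = Σ_k e k · r k j`
  set hh : Fin 2 → CompletedAlgClosure F := fun i => thetaBdR (a (v i)) with hhh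
  set ee : Fin 2 → CompletedAlgClosure F := fun i => thetaBdR (c (v i)) with hee
  have hH : ∀ σ j, χC σ * σ • hh j = ∑ k, hh k * ιC (R σ k j) := fun σ j => by
    have h := congrArg thetaBdR (hE₁ σ j)
    rw [map_mul, hχθ, thetaBdR_galBdRPlus, map_sum] at h
    rw [h]
    exact Finset.sum_congr rfl fun k _ => by rw [map_mul, hιθ]
  have hEE : ∀ σ j, σ • ee j = ∑ k, ee k * ιC (R σ k j) := fun σ j => by
    have h := congrArg thetaBdR (hE₂ σ j)
    rw [thetaBdR_galBdRPlus, map_sum] at h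
    rw [h]
    exact Finset.sum_congr rfl fun k _ => by rw [map_mul, hιθ]
  -- `Δ ∈ Fil²` forces `h 0 · e 1 = h 1 · e 0`
  have hdet0 : hh 0 * ee 1 = hh 1 * ee 0 := by
    obtain ⟨d, hd⟩ := (mem_fil 2 _).1 hΔ
    rw [ha (v 0), ha (v 1), hc (v 0), hc (v 1)] at hd
    -- re-read `hd` in `B_dR = Frac B_dR⁺`
    have hd1 : alg tBdR * alg (a (v 0)) * alg (c (v 1)) - alg tBdR * alg (a (v 1)) * alg (c (v 0)) =
        alg xiBdR ^ (2 : ℤ) * alg d := hd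
    have h2 : alg xiBdR ^ (2 : ℤ) * alg d = alg (xiBdR * xiBdR * d) := by
      rw [show (2 : ℤ) = ((2 : ℕ) : ℤ) from rfl, zpow_natCast, map_mul, map_mul, pow_two]
    rw [h2, htw] at hd1
    have hd' : alg (xiBdR * (w * (a (v 0) * c (v 1) - a (v 1) * c (v 0)))) = alg (xiBdR * (xiBdR * d)) := by
      rw [← mul_assoc xiBdR xiBdR d, ← hd1]
      simp only [map_mul, map_sub]
      ring
    have hd'' := mul_left_cancel₀ hξ0 (halg hd')
    have hmem : w * (a (v 0) * c (v 1) - a (v 1) * c (v 0)) ∈ Ideal.span {(xiBdR : BDeRhamPlus (integerC F) p)} :=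
      Ideal.mem_span_singleton'.2 ⟨d, by rw [hd'', mul_comm]⟩
    have hmem' : a (v 0) * c (v 1) - a (v 1) * c (v 0) ∈ Ideal.span {(xiBdR : BDeRhamPlus (integerC F) p)} := by
      have := Ideal.mul_mem_left _ ((hw.unit⁻¹ : (BDeRhamPlus (integerC F) p)ˣ) : BDeRhamPlus (integerC F) p) hmem
      rwa [← mul_assoc, IsUnit.val_inv_mul, one_mul] at this
    have h0 := thetaBdR_eq_zero_of_mem_span hmem'
    rw [map_sub, map_mul, map_mul, sub_eq_zero] at h0
    exact h0
  -- consequences for general `m` from the basis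
  have fil_of_basis : ∀ (φ : M →ₗ[ℚ_[p]] (bdRPeriodRingData (F := F) (p := p) hp).B) (i : ℤ),
      (∀ k, φ (v k) ∈ (bdRPeriodRingData (F := F) (p := p) hp).fil i) →
      ∀ m, φ m ∈ (bdRPeriodRingData (F := F) (p := p) hp).fil i := fun φ i hk m => by
    rw [← v.sum_repr m, map_sum]
    refine Submodule.sum_mem _ fun k _ => ?_
    rw [map_smul, ← algebraMap_smul F (v.repr m k) (φ (v k))]
    exact Submodule.smul_mem _ _ (hk k)
  -- case `e⃗ = 0`: `φ₂(V) ⊆ Fil¹`, contradiction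
  by_cases he : ee 0 = 0 ∧ ee 1 = 0
  · obtain ⟨m₂, hm₂⟩ := hnot
    apply hm₂
    refine fil_of_basis φ₂ 1 (fun k => ?_) m₂
    have hk : thetaBdR (c (v k)) = 0 := by fin_cases k; exacts [he.1, he.2]
    rw [mem_ker_thetaBdR_iff, Ideal.mem_span_singleton'] at hk
    obtain ⟨c', hc'⟩ := hk
    rw [mem_fil 1, hc (v k)]
    exact ⟨c', by rw [zpow_one, ← map_mul, ← hc', mul_comm]⟩
  · -- case `e⃗ ≠ 0`: `h⃗ = λ e⃗`
    obtain ⟨i₀, hi₀⟩ : ∃ i₀ : Fin 2, ee i₀ ≠ 0 := by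
      by_cases h0 : ee 0 = 0
      · exact ⟨1, fun h1 => he ⟨h0, h1⟩⟩
      · exact ⟨0, h0⟩
    set lam : CompletedAlgClosure F := hh i₀ / ee i₀ with hlam
    have hprop : ∀ i, hh i = lam * ee i := by
      have key : ∀ i j : Fin 2, hh i * ee j = hh j * ee i := by
        intro i j
        fin_cases i <;> fin_cases j
        · rfl
        · exact hdet0
        · exact hdet0.symm
        · rfl
      intro i
      rw [hlam, div_mul_eq_mul_div, key i₀ i, mul_div_assoc, div_self hi₀, mul_one]
    -- Galois: `(χ(σ) σ(λ) − λ) σ(e i₀) = 0`, hence `σ λ = χ(σ)⁻¹ λ`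
    have hgal : ∀ σ : absoluteGaloisGroup F, σ • lam = χC σ ^ (-1 : ℤ) * lam := fun σ => by
      have hA := hH σ i₀
      simp_rw [hprop] at hA
      rw [smul_mul', ← mul_assoc] at hA
      have hB : ∑ k, lam * ee k * ιC (R σ k i₀) = lam * σ • ee i₀ := by
        rw [hEE σ i₀, Finset.mul_sum]
        exact Finset.sum_congr rfl fun k _ => by rw [mul_assoc]
      rw [hB] at hA
      have hσe : σ • ee i₀ ≠ 0 := fun h0 => hi₀ ((smul_eq_zero_iff_eq σ).1 h0)
      have hA' := mul_right_cancel₀ hσe hA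
      -- `χ σ * σ lam = lam`
      have hχ0 := algebraMap_padicRingHom_cyclotomicCharacter_ne_zero hp σ
      rw [zpow_neg, zpow_one, eq_inv_mul_iff_mul_eq₀ hχ0]
      exact hA'
    have hlam0 : lam = 0 :=
      CompletedAlgClosure.eq_zero_of_forall_smul_eq_cyclotomicCharacter_zpow hp (j := -1) (by norm_num) hgal
    -- hence `h⃗ = 0`, `φ₁(V) ⊆ Fil²`, contradiction
    obtain ⟨m₁, hm₁⟩ := hne
    apply hm₁
    refine fil_of_basis φ₁ 2 (fun k => ?_) m₁
    have hk : thetaBdR (a (v k)) = 0 := by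
      have := hprop k
      rw [hlam0, zero_mul] at this
      exact this
    rw [mem_ker_thetaBdR_iff, Ideal.mem_span_singleton'] at hk
    obtain ⟨a', ha'⟩ := hk
    rw [mem_fil 2, ha (v k)]
    refine ⟨w * a', ?_⟩
    rw [show (2 : ℤ) = ((2 : ℕ) : ℤ) from rfl, zpow_natCast, ← map_pow, ← map_mul, ← map_mul, htw, ← ha']
    congr 1
    ring

end Literature.NumberTheory.PAdicHodge

end
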